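import Summits.ResolutionOfSingularities.ResolutionOfSingularities.Theorems.FrobeniusLadderFInjectiveMacaulayficationClauseOfPderivNotMem
import Mathlib.RingTheory.MvPolynomial.WeightedHomogeneous
import Mathlib.Algebra.MvPolynomial.PDeriv
import Mathlib.Tactic.LinearCombination
import HarnessLib

/-!
# The weighted blow-up of `f₄ = X₂² + X₀³ + X₁⁶ + X₃³X₀²` in characteristic `5`: the `X₀`-chart

Support file for crux stmt-ResolutionOfSingularities-15315
(`FrobeniusLadder.FInjectiveMacaulayfication`, registered skeleton `10f06f91`, line `Sketch`, §15 THE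
WEIGHTED CONE ENGINE, calibration specimen `f₄`): registered stub `stub_f4ChartX`.

Let `k` be a field of characteristic `5`, `S = k[X₀, X₁, X₂, X₃]`, `f₄ = X₂² + X₀³ + X₁⁶ + X₃³X₀²`
(weighted homogeneous of degree `N = 18` for the weights `w = (6, 3, 9, 2)`). The `X₀`-chart of the
weighted blow-up of the origin is governed by the root-cover substitution
`θ₀ : X₀ ↦ X₀⁶, Xⱼ ↦ Xⱼ X₀^{wⱼ} (j ≠ 0)`, under which `θ₀ f₄ = X₀¹⁸ · g` with the chart polynomial
`g = X₂² + 1 + X₁⁶ + X₃³`. What is proved (`stub_f4ChartX`, the registered signature verbatim):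

* the chart identity `θ₀ f₄ = X₀¹⁸ g` (`ring` after expanding `aeval`);
* `g` is weighted homogeneous of weight `0` for the residual weights `W = e₀ - w = (1, -3, -9, -2)`
  in `ZMod 6` (monomial by monomial: `isWeightedHomogeneous_X`, `.pow`, `.mul`, `.add`; the weights
  `2·(-9)`, `0`, `6·(-3)`, `3·(-2)` vanish in `ZMod 6` by `decide`);
* `X₀ ∤ g` (the evaluation at the origin kills `X₀` and sends `g` to `1`);
* at EVERY maximal ideal `Q` of `S/(g)` the local ring `(S/(g))_Q` satisfies the per-stalk clause of
  the crux (every system of parameters weakly regular and generating a Frobenius closed ideal): the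
  chart is SMOOTH — if the partials `∂₁g = 6X₁⁵`, `∂₂g = 2X₂`, `∂₃g = 3X₃²` all lay in the maximal
  ideal `P = Q ∩ S ∋ g`, then `X₁, X₂, X₃ ∈ P` (`6, 2, 3` are units in characteristic `5`), hence
  `1 = g - X₂² - X₁⁶ - X₃³ ∈ P`; so some partial misses `P` and the Jacobian discharger
  `ClauseOfPderivNotMem.stub_clauseOfPderivNotMem` applies.

References: [Matsumura1987] H. Matsumura, *Commutative Ring Theory*, Thm. 30.4 (through the imported
Jacobian discharger). The computation itself is folklore. Sibling file: `…F4ChartY.lean` (the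
`X₁`-chart, same pattern).
-/

-- single-problem summit: the doubled namespace component is forced
set_option linter.dupNamespace false

noncomputable section

namespace Summit.ResolutionOfSingularities.ResolutionOfSingularities.Theorems.FInjectiveMacaulayfication.F4ChartX

open MvPolynomial
open Summit.ResolutionOfSingularities.ResolutionOfSingularities.Theorems.FInjectiveMacaulayfication

/-! ## The partial derivatives of the chart polynomial -/

/-- **`∂g/∂X₁ = 6X₁⁵`** for `g = X₂² + 1 + X₁⁶ + X₃³`, over any commutative ring. [folklore] -/
theorem pderiv_one_g {A : Type*} [CommRing A] :
    pderiv 1 (X 2 ^ 2 + 1 + X 1 ^ 6 + X 3 ^ 3 : MvPolynomial (Fin 4) A) = 6 * X 1 ^ 5 := by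
  simp only [map_add, pderiv_one, pderiv_pow, pderiv_X_self,
    pderiv_X_of_ne (show (2 : Fin 4) ≠ 1 by decide), pderiv_X_of_ne (show (3 : Fin 4) ≠ 1 by decide),
    Nat.reduceSub, mul_one, mul_zero, add_zero, zero_add, Nat.cast_ofNat]

/-- **`∂g/∂X₂ = 2X₂`** for `g = X₂² + 1 + X₁⁶ + X₃³`, over any commutative ring. [folklore] -/
theorem pderiv_two_g {A : Type*} [CommRing A] :
    pderiv 2 (X 2 ^ 2 + 1 + X 1 ^ 6 + X 3 ^ 3 : MvPolynomial (Fin 4) A) = 2 * X 2 := by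
  simp only [map_add, pderiv_one, pderiv_pow, pderiv_X_self,
    pderiv_X_of_ne (show (1 : Fin 4) ≠ 2 by decide), pderiv_X_of_ne (show (3 : Fin 4) ≠ 2 by decide),
    Nat.reduceSub, pow_one, mul_one, mul_zero, add_zero, Nat.cast_ofNat]

/-- **`∂g/∂X₃ = 3X₃²`** for `g = X₂² + 1 + X₁⁶ + X₃³`, over any commutative ring. [folklore] -/
theorem pderiv_three_g {A : Type*} [CommRing A] :
    pderiv 3 (X 2 ^ 2 + 1 + X 1 ^ 6 + X 3 ^ 3 : MvPolynomial (Fin 4) A) = 3 * X 3 ^ 2 := by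
  simp only [map_add, pderiv_one, pderiv_pow, pderiv_X_self,
    pderiv_X_of_ne (show (1 : Fin 4) ≠ 3 by decide), pderiv_X_of_ne (show (2 : Fin 4) ≠ 3 by decide),
    Nat.reduceSub, mul_one, mul_zero, add_zero, zero_add, Nat.cast_ofNat]

/-! ## Weighted homogeneity of the chart polynomial -/

/-- **`g = X₂² + 1 + X₁⁶ + X₃³` is weighted homogeneous of weight `0`** for the residual weights
`W = (1, -3, -9, -2)` with values in `ZMod 6` (i.e. `W = (1, 3, 3, 4)`): every monomial has weight
`0` (`2·3 = 6`, `0`, `6·3 = 18`, `3·4 = 12`). [folklore] -/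
theorem isWeightedHomogeneous_g (k : Type) [Field k] :
    MvPolynomial.IsWeightedHomogeneous (![1, -3, -9, -2] : Fin 4 → ZMod 6)
      (X 2 ^ 2 + 1 + X 1 ^ 6 + X 3 ^ 3 : MvPolynomial (Fin 4) k) 0 := by
  have hX : ∀ j : Fin 4, IsWeightedHomogeneous (![1, -3, -9, -2] : Fin 4 → ZMod 6)
      (X j : MvPolynomial (Fin 4) k) ((![1, -3, -9, -2] : Fin 4 → ZMod 6) j) :=
    fun j => isWeightedHomogeneous_X k _ j
  have h2 : IsWeightedHomogeneous (![1, -3, -9, -2] : Fin 4 → ZMod 6)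
      (X 2 ^ 2 : MvPolynomial (Fin 4) k) 0 := by
    have h := (hX 2).pow 2
    rwa [show 2 • (![1, -3, -9, -2] : Fin 4 → ZMod 6) 2 = 0 from by decide] at h
  have h1 : IsWeightedHomogeneous (![1, -3, -9, -2] : Fin 4 → ZMod 6)
      (1 : MvPolynomial (Fin 4) k) 0 := isWeightedHomogeneous_one k _
  have h16 : IsWeightedHomogeneous (![1, -3, -9, -2] : Fin 4 → ZMod 6)
      (X 1 ^ 6 : MvPolynomial (Fin 4) k) 0 := by
    have h := (hX 1).pow 6
    rwa [show 6 • (![1, -3, -9, -2] : Fin 4 → ZMod 6) 1 = 0 from by decide] at h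
  have h33 : IsWeightedHomogeneous (![1, -3, -9, -2] : Fin 4 → ZMod 6)
      (X 3 ^ 3 : MvPolynomial (Fin 4) k) 0 := by
    have h := (hX 3).pow 3
    rwa [show 3 • (![1, -3, -9, -2] : Fin 4 → ZMod 6) 3 = 0 from by decide] at h
  exact ((h2.add h1).add h16).add h33

/-! ## Registered form -/

/-- **THE `X₀`-CHART OF THE WEIGHTED BLOW-UP OF `f₄`** (registered stub `stub_f4ChartX` of line
`Sketch`, §15 weighted cone engine, specimen `f₄ = X₂² + X₀³ + X₁⁶ + X₃³X₀²`, weights `(6,3,9,2)`,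
`N = 18`, characteristic `5`). With `g = X₂² + 1 + X₁⁶ + X₃³`: (i) the root-cover substitution
`θ₀ : X₀ ↦ X₀⁶, Xⱼ ↦ XⱼX₀^{wⱼ}` gives `θ₀ f₄ = X₀¹⁸ g` (`ring`); (ii) `g` is weighted homogeneous of
weight `0` for `W = (1, -3, -9, -2) : Fin 4 → ZMod 6` (`isWeightedHomogeneous_g`); (iii) `X₀ ∤ g`
(evaluate at the origin: `g ↦ 1`, `X₀ ↦ 0`); (iv) at every maximal ideal `Q` of `k[X]/(g)` the local
ring satisfies the per-stalk clause of the crux — the chart is smooth: were `∂₁g, ∂₂g, ∂₃g` all in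
`P = Q ∩ k[X]`, then `X₁, X₂, X₃ ∈ P` and `1 = g - X₂² - X₁⁶ - X₃³ ∈ P`, absurd; so the Jacobian
discharger `ClauseOfPderivNotMem.stub_clauseOfPderivNotMem` applies in some direction.
[cite: Matsumura1987, Thm. 30.4 (ii)] -/
theorem stub_f4ChartX : ∀ (k : Type) [Field k] [CharP k 5] (f g : MvPolynomial (Fin 4) k), f = MvPolynomial.X 2 ^ 2 + MvPolynomial.X 0 ^ 3 + MvPolynomial.X 1 ^ 6 + MvPolynomial.X 3 ^ 3 * MvPolynomial.X 0 ^ 2 → g = MvPolynomial.X 2 ^ 2 + 1 + MvPolynomial.X 1 ^ 6 + MvPolynomial.X 3 ^ 3 → MvPolynomial.aeval (fun j : Fin 4 => if j = 0 then (MvPolynomial.X 0 : MvPolynomial (Fin 4) k) ^ 6 else MvPolynomial.X j * MvPolynomial.X 0 ^ ((![6, 3, 9, 2] : Fin 4 → ℕ) j)) f = MvPolynomial.X 0 ^ 18 * g ∧ MvPolynomial.IsWeightedHomogeneous (![1, -3, -9, -2] : Fin 4 → ZMod 6) g 0 ∧ ¬ (MvPolynomial.X 0 : MvPolynomial (Fin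 4) k) ∣ g ∧ ∀ (Q : Ideal (MvPolynomial (Fin 4) k ⧸ Ideal.span {g})) [Q.IsMaximal], ∀ d : ℕ, ringKrullDim (Localization.AtPrime Q) = d → ∀ s : Fin d → Localization.AtPrime Q, (Ideal.span (Set.range s)).radical.IsMaximal → RingTheory.Sequence.IsWeaklyRegular (Localization.AtPrime Q) (List.ofFn s) ∧ ∀ y : Localization.AtPrime Q, (∃ e : ℕ, y ^ 5 ^ e ∈ Ideal.span ((fun z : Localization.AtPrime Q => z ^ 5 ^ e) '' (Ideal.span (Set.range s) : Set (Localization.AtPrime Q)))) → y ∈ Ideal.span (Set.range s) := by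
  intro k _ _ f g hf hg
  haveI : Fact (Nat.Prime 5) := ⟨Nat.prime_five⟩
  refine ⟨?_, hg ▸ isWeightedHomogeneous_g k, ?_, ?_⟩
  · -- (i) the chart identity
    subst hf hg
    simp only [map_add, map_mul, map_pow, MvPolynomial.aeval_X, Fin.isValue, Fin.reduceEq,
      ↓reduceIte, Matrix.cons_val_one, Matrix.cons_val]
    ring
  · -- (iii) `X₀ ∤ g`: evaluate at the origin
    rintro ⟨h, hh⟩
    have h1 := congrArg (MvPolynomial.eval fun _ : Fin 4 => (0 : k)) hh
    rw [hg] at h1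
    simp only [map_add, map_mul, map_pow, map_one, MvPolynomial.eval_X, Fin.isValue] at h1
    norm_num at h1
  · -- (iv) the clause at every closed point: the chart is smooth
    intro Q _ d hd s hs
    haveI hP₀max : (Q.comap (Ideal.Quotient.mk (Ideal.span {g}))).IsMaximal :=
      Ideal.comap_isMaximal_of_surjective _ Ideal.Quotient.mk_surjective
    have hP₀ := hP₀max.isPrime
    -- arithmetic of characteristic `5` in `k[X]`
    have h5 : (5 : MvPolynomial (Fin 4) k) = 0 := by
      exact_mod_cast CharP.cast_eq_zero (MvPolynomial (Fin 4) k) 5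
    have hu2 : IsUnit (2 : MvPolynomial (Fin 4) k) :=
      IsUnit.of_mul_eq_one 3 (by linear_combination h5)
    have hu3 : IsUnit (3 : MvPolynomial (Fin 4) k) :=
      IsUnit.of_mul_eq_one 2 (by linear_combination h5)
    have hu6 : IsUnit (6 : MvPolynomial (Fin 4) k) :=
      IsUnit.of_mul_eq_one 1 (by linear_combination h5)
    -- the partial derivatives
    have hd1 : pderiv 1 g = 6 * X 1 ^ 5 := by rw [hg, pderiv_one_g]
    have hd2 : pderiv 2 g = 2 * X 2 := by rw [hg, pderiv_two_g]
    have hd3 : pderiv 3 g = 3 * X 3 ^ 2 := by rw [hg, pderiv_three_g]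
    -- off the singular locus: the Jacobian discharger in direction `j`
    by_cases hm2 : pderiv 2 g ∈ Q.comap (Ideal.Quotient.mk (Ideal.span {g})); swap
    · exact ClauseOfPderivNotMem.stub_clauseOfPderivNotMem 5 k 4 g Q 2 hm2 d hd s hs
    by_cases hm1 : pderiv 1 g ∈ Q.comap (Ideal.Quotient.mk (Ideal.span {g})); swap
    · exact ClauseOfPderivNotMem.stub_clauseOfPderivNotMem 5 k 4 g Q 1 hm1 d hd s hs
    by_cases hm3 : pderiv 3 g ∈ Q.comap (Ideal.Quotient.mk (Ideal.span {g})); swap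
    · exact ClauseOfPderivNotMem.stub_clauseOfPderivNotMem 5 k 4 g Q 3 hm3 d hd s hs
    -- all partials vanish at `Q`: impossible, the chart is smooth
    exfalso
    have hgP : g ∈ Q.comap (Ideal.Quotient.mk (Ideal.span {g})) := by
      rw [Ideal.mem_comap, Ideal.Quotient.eq_zero_iff_mem.mpr (Ideal.mem_span_singleton_self g)]
      exact Q.zero_mem
    have hX2 : (X 2 : MvPolynomial (Fin 4) k) ∈ Q.comap (Ideal.Quotient.mk (Ideal.span {g})) := by
      rw [hd2] at hm2
      exact (Ideal.unit_mul_mem_iff_mem _ hu2).mp hm2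
    have hX1 : (X 1 : MvPolynomial (Fin 4) k) ∈ Q.comap (Ideal.Quotient.mk (Ideal.span {g})) := by
      rw [hd1] at hm1
      exact hP₀.mem_of_pow_mem 5 ((Ideal.unit_mul_mem_iff_mem _ hu6).mp hm1)
    have hX3 : (X 3 : MvPolynomial (Fin 4) k) ∈ Q.comap (Ideal.Quotient.mk (Ideal.span {g})) := by
      rw [hd3] at hm3
      exact hP₀.mem_of_pow_mem 2 ((Ideal.unit_mul_mem_iff_mem _ hu3).mp hm3)
    have h1 : (1 : MvPolynomial (Fin 4) k) ∈ Q.comap (Ideal.Quotient.mk (Ideal.span {g})) := by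
      have e : (1 : MvPolynomial (Fin 4) k) = g - (X 2 * X 2 + X 1 ^ 5 * X 1 + X 3 ^ 2 * X 3) := by
        rw [hg]; ring
      rw [e]
      exact Ideal.sub_mem _ hgP (Ideal.add_mem _ (Ideal.add_mem _ (Ideal.mul_mem_left _ _ hX2)
        (Ideal.mul_mem_left _ _ hX1)) (Ideal.mul_mem_left _ _ hX3))
    exact hP₀max.ne_top ((Ideal.eq_top_iff_one _).mpr h1)

end Summit.ResolutionOfSingularities.ResolutionOfSingularities.Theorems.FInjectiveMacaulayfication.F4ChartX

end
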